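import Mathlib
import Summits.NavierStokesRegularity.NavierStokesRegularity.Theorems.EulerZoomLiouvillePowerGaugeEulerLiouvilleSelfSimilarBernoulliSqueezeFreeExit
import HarnessLib

/-!
# «FAST VORTICAL CHANNELS SQUEEZE VOLUME TOO FAST» — THE (C2) VOLUME SQUEEZE WITH THE ONE-SIDED CHANNEL ONLY: NO GROWTH HYPOTHESIS, NO UPPER RATE
# (crux `EulerZoomLiouville.PowerGaugeEulerLiouville` = stmt-NavierStokesRegularity-19832, line `birth`, THE ONE STATEMENT; LEAD's RESIDUE-MEMO-19832-g12 target T3)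

Route №10 `EulerZoomLiouville` (NavierStokesRegularity); width seat ns-ezl-w5 g2.  The seat's g0 vortical squeeze (p635086) with its only non-dynamical
hypothesis — the global linear growth `‖U y‖ ≤ K₁(1+‖y‖)` — REMOVED, and the pinched form (p642094) with its upper radial rate REMOVED: the channel is asked
ONE-SIDEDLY, `⟪y, γy + U y⟫ ≤ −c₁‖y‖²` at the far vortical points of each high set, and nothing else beyond the class `A`-growth `∫_{B_L}|U|² ≤ c_A L^θ`
(`θ < 2`).  MECHANISM: fix `T`; for a cut-off radius `M` split the blob `A` of far vortical Bernoulli-high points into the points whose backward cut-off orbit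
STAYS in `‖z‖ ≤ M/2` on `[0,T]` — for these «inside ⇒ good» (`Loc.backwardOrbit_good_of_inside`) and the volume law give the old bound
`C(R−1)^{−m}e^{(3γ−c₁m)T}` — and the EXIT SET, whose measure is `≲_T γ²·vol({ℋ>h} ∩ {‖z‖ ≥ M/4}) + M^{−2}∫_{B_M}|U|² → 0` as `M → ∞`
(`Loc.volume_exitSet_mul_le`: each exiting orbit crosses the shell `[M/4, M/2]` as a true vortical Bernoulli-high orbit, `(log 2)² ≤ T∫(radial rate)²`, Tonelli,
change of variables).  Letting `M → ∞` and then `T → ∞`: `vol A = 0`, absurd.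

* **`Loc.curl_eq_zero_of_vorticalFastChannel_of_thin_free`** — `(U,P)` a `C²` CIV (3.3) profile, `0 < γ < ½`, `∫_{B_L}|U|² ≤ c_A L^θ` (`θ < 2`); high sets thin
  with rate `m > 0` far out; one-sided channel of rate `c₁` at the far vortical points of every high set; `3γ < c₁ m` ⇒ `curl U ≡ 0`.

With the growth-free Sobolev thinness `m = 3+3ρ` (`…SqueezePinchedMember`, `Loc.volume_bernoulliHigh_inter_far_le_sobolev_free`) the members
(`…SqueezeFreeMember`) have EXACTLY the hypotheses of the LEAD's `…_sharp` (p639458) / this seat's past twin (p640502) minus `hK₁`: the binder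
`HasFastVorticalChannel` loses its linear-growth conjunct; THE ONE STATEMENT's (N3) residue = «slow (tangential / pressurised) far vortical high points» only.
HONEST LABEL: a dynamical sub-stratum of THE ONE STATEMENT.  WHAT THIS IS NOT: not NS, not E — 19832 is a crux CLASS on the MODEL lattice (E/NS strata) and stays
OPEN; NS regularity is NOT proved. [folklore; ConstantinIgnatovaVicol2026Putative §3.4.1 (3.21)–(3.22), §3.4.3 (3.30)–(3.33)]
-/

noncomputable section

-- flat `Theorems/<Route><Decl>…` files of one crux share the namespace of the crux (tree convention)
set_option linter.dupNamespace false

open MeasureTheory Set Filter Topology Metric Function InnerProductSpace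
open scoped RealInnerProductSpace NNReal ENNReal ContDiff

namespace Summit.NavierStokesRegularity.NavierStokesRegularity.Theorems.PowerGaugeEulerLiouville.Loc

open Literature.Analysis Literature.Analysis.FluidPDE
open Summit.NavierStokesRegularity.NavierStokesRegularity.Theorems.PowerGaugeEulerLiouville.BernoulliLandscape
open Summit.NavierStokesRegularity.NavierStokesRegularity.Theorems.PowerGaugeEulerLiouville.BackwardEscape
open Summit.NavierStokesRegularity.NavierStokesRegularity.Theorems.PowerGaugeEulerLiouville.NodalFiniteness

variable {γ : ℝ} {U : EuclideanSpace ℝ (Fin 3) → EuclideanSpace ℝ (Fin 3)} {P : EuclideanSpace ℝ (Fin 3) → ℝ}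

/-- The error term of the exit estimate tends to `0`: `κ₁ (M/4)^{−m} + κ₂ M^{θ−2} → 0` as `M → ∞` (`m > 0`, `θ < 2`). [folklore] -/
theorem tendsto_exitError {m θ κ₁ κ₂ : ℝ} (hm : 0 < m) (hθ : θ < 2) :
    Tendsto (fun M : ℝ => κ₁ * (M / 4) ^ (-m) + κ₂ * M ^ (θ - 2)) atTop (𝓝 0) := by
  have h1 : Tendsto (fun M : ℝ => (M / 4) ^ (-m)) atTop (𝓝 0) :=
    (tendsto_rpow_neg_atTop hm).comp (tendsto_id.atTop_div_const (by norm_num))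
  have h2 : Tendsto (fun M : ℝ => M ^ (θ - 2)) atTop (𝓝 0) := by
    have : θ - 2 = -(2 - θ) := by ring
    rw [this]
    exact tendsto_rpow_neg_atTop (by linarith)
  have := (h1.const_mul κ₁).add (h2.const_mul κ₂)
  simpa using this

set_option maxHeartbeats 800000 in
/-- **FAST VORTICAL CHANNELS SQUEEZE VOLUME TOO FAST — ONE-SIDED CHANNEL ONLY, NO GROWTH HYPOTHESIS.**  `(U, P)` a `C²` self-similar Euler profile (CIV (3.3)),
`0 < γ < ½`, with the energy growth `∫_{B_L}|U|² ≤ c_A L^θ` (`θ < 2`); every high set `Θ_h = {ℋ > h}` thin with rate `m > 0` far out; the ONE-SIDED CHANNEL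
`⟪y, γy + U y⟫ ≤ −c₁‖y‖²` at the far VORTICAL points of every `Θ_h`; `3γ < c₁ m`.  Then `curl U ≡ 0`. [folklore; ConstantinIgnatovaVicol2026Putative §3.4] -/
theorem curl_eq_zero_of_vorticalFastChannel_of_thin_free (hprof : IsSelfSimilarEulerProfile γ 0 U P) (hγ : 0 < γ) (hγ2 : γ < 1 / 2)
    {cA θ : ℝ} (hθ : θ < 2)
    (hA : ∀ L : ℝ, 0 < L → ∫⁻ y in ball (0 : EuclideanSpace ℝ (Fin 3)) L, ‖U y‖ₑ ^ 2 ≤ ENNReal.ofReal (cA * L ^ θ))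
    {m c₁ : ℝ} (hm : 0 < m) (hc₁ : 0 < c₁) (hrace : 3 * γ < c₁ * m)
    (hthin : ∀ h : ℝ, ∃ C R₂ : ℝ, 0 < R₂ ∧ ∀ R : ℝ, R₂ ≤ R →
      volume ({y : EuclideanSpace ℝ (Fin 3) | h < selfSimilarBernoulli γ 0 U P y} ∩ {y | R ≤ ‖y‖}) ≤
        ENNReal.ofReal (C * R ^ (-m)))
    (hfast : ∀ h : ℝ, ∃ R₀ : ℝ, ∀ y : EuclideanSpace ℝ (Fin 3), R₀ ≤ ‖y‖ → h < selfSimilarBernoulli γ 0 U P y →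
      curl U y ≠ 0 → ⟪y, selfSimilarTransport γ 0 U y⟫ ≤ -(c₁ * ‖y‖ ^ 2))
    (x₀ : EuclideanSpace ℝ (Fin 3)) : curl U x₀ = 0 := by
  -- adapted from `Loc.curl_eq_zero_of_vorticalFastChannel_of_thin` (p635086) and `…pinchedVorticalChannel…` (p642094), this seat
  by_contra hx₀
  set Hb : EuclideanSpace ℝ (Fin 3) → ℝ := selfSimilarBernoulli γ 0 U P with hHb
  have hHc : Continuous Hb := hprof.contDiff_selfSimilarBernoulli.continuous
  have hγ2' : γ ≤ 1 / 2 := hγ2.le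
  set h : ℝ := Hb x₀ - 1 with hh
  obtain ⟨C, R₂, hR₂, hthinR⟩ := hthin h
  obtain ⟨R₀, hfastR⟩ := hfast h
  set C' : ℝ := max C 0 with hC'
  have hC'0 : 0 ≤ C' := le_max_right _ _
  have hthinR' : ∀ R : ℝ, R₂ ≤ R →
      volume ({y : EuclideanSpace ℝ (Fin 3) | h < Hb y} ∩ {y | R ≤ ‖y‖}) ≤ ENNReal.ofReal (C' * R ^ (-m)) :=
    fun R hR => (hthinR R hR).trans (ENNReal.ofReal_le_ofReal
      (mul_le_mul_of_nonneg_right (le_max_left _ _) (Real.rpow_nonneg (hR₂.le.trans hR) _)))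
  set cA' : ℝ := max cA 0 with hcA'
  have hcA'0 : 0 ≤ cA' := le_max_right _ _
  have hA' : ∀ L : ℝ, 0 < L → ∫⁻ y in ball (0 : EuclideanSpace ℝ (Fin 3)) L, ‖U y‖ₑ ^ 2 ≤ ENNReal.ofReal (cA' * L ^ θ) :=
    fun L hL => (hA L hL).trans (ENNReal.ofReal_le_ofReal
      (mul_le_mul_of_nonneg_right (le_max_left _ _) (Real.rpow_nonneg hL.le _)))
  set R : ℝ := max (max R₀ R₂) (max ‖x₀‖ 1) + 1 with hRdef
  have hRR₀ : R₀ ≤ R - 1 := by rw [hRdef]; linarith [le_max_left R₀ R₂, le_max_left (max R₀ R₂) (max ‖x₀‖ 1)]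
  have hRR₂ : R₂ ≤ R - 1 := by rw [hRdef]; linarith [le_max_right R₀ R₂, le_max_left (max R₀ R₂) (max ‖x₀‖ 1)]
  have hR1 : 1 ≤ R - 1 := by rw [hRdef]; linarith [le_max_right ‖x₀‖ 1, le_max_right (max R₀ R₂) (max ‖x₀‖ 1)]
  have hRx₀ : ‖x₀‖ < R := by rw [hRdef]; linarith [le_max_left ‖x₀‖ 1, le_max_right (max R₀ R₂) (max ‖x₀‖ 1)]
  have hR0 : 0 < R - 1 := by linarith
  have hhx₀ : h < Hb x₀ := by rw [hh]; linarith
  obtain ⟨y₀, hy₀R, -, hy₀curl, hy₀h⟩ := exists_fastInflow_vortical_bernoulli_gt hprof hγ hγ2 hx₀ hhx₀ hRx₀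
  have hcurlc : Continuous (curl U) := (differentiable_curl_of_contDiff hprof.contDiff_velocity).continuous
  have hO : IsOpen ({y : EuclideanSpace ℝ (Fin 3) | h < Hb y} ∩ {y | curl U y ≠ 0}) :=
    (isOpen_lt continuous_const hHc).inter (isOpen_ne_fun hcurlc continuous_const)
  obtain ⟨ε, hε, hεsub⟩ := Metric.isOpen_iff.1 hO y₀ ⟨hy₀h, hy₀curl⟩
  set r : ℝ := min ε 1 / 2 with hr
  have hr0 : 0 < r := by rw [hr]; positivity
  have hrε : r < ε := by rw [hr]; linarith [min_le_left ε 1]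
  have hr1 : r < 1 := by rw [hr]; linarith [min_le_right ε 1]
  set A : Set (EuclideanSpace ℝ (Fin 3)) := ball y₀ r with hA
  have hAm : MeasurableSet A := measurableSet_ball
  have hAh : ∀ y ∈ A, h < Hb y := fun y hy => (hεsub (ball_subset_ball hrε.le hy)).1
  have hAcurl : ∀ y ∈ A, curl U y ≠ 0 := fun y hy => (hεsub (ball_subset_ball hrε.le hy)).2
  have hAR : ∀ y ∈ A, R - 1 < ‖y‖ := fun y hy => by
    have h1 : ‖y₀‖ - ‖y‖ ≤ ‖y₀ - y‖ := norm_sub_norm_le y₀ y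
    rw [hA, mem_ball] at hy; rw [← dist_eq_norm, dist_comm] at h1; linarith
  have hAR1 : ∀ y ∈ A, ‖y‖ < R + 1 := fun y hy => by
    rw [hA, mem_ball] at hy
    have h1 : ‖y‖ - ‖y₀‖ ≤ ‖y - y₀‖ := norm_sub_norm_le y y₀
    rw [← dist_eq_norm] at h1
    linarith
  have hAR₀ : ∀ y ∈ A, R₀ ≤ ‖y‖ := fun y hy => hRR₀.trans (hAR y hy).le
  have hA0 : ∀ y ∈ A, 0 < ‖y‖ := fun y hy => lt_of_lt_of_le (by linarith) (hAR y hy).le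
  have hApos : 0 < volume A := measure_ball_pos volume y₀ hr0
  have hAtop : volume A < ⊤ := measure_ball_lt_top
  -- ### the squeeze with an error term: for `T > 0` and every large cut-off radius `M`
  have hkey : ∀ T : ℝ, 0 < T → ∀ M : ℝ, 4 * (R + 1) ≤ M →
      volume A ≤ ENNReal.ofReal (C' * (R - 1) ^ (-m) * Real.exp ((3 * γ - c₁ * m) * T)) +
        ENNReal.ofReal T * ENNReal.ofReal (Real.exp (3 * γ * T)) *
          (ENNReal.ofReal (2 * γ ^ 2) * ENNReal.ofReal (C' * (M / 4) ^ (-m)) +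
            ENNReal.ofReal (32 / M ^ 2) * ENNReal.ofReal (cA' * M ^ θ)) / ENNReal.ofReal ((Real.log 2) ^ 2 / T) := by
    intro T hT M hM
    have hM0 : 0 < M := by linarith
    set Rbig : ℝ := M + 2 with hRbig
    have hRbig0 : 0 < Rbig := by rw [hRbig]; linarith
    obtain ⟨V, hV2, ⟨M', hM'⟩, hsmul, ⟨K, hK⟩, hVU⟩ := exists_cutoff_local_smul hprof.contDiff_velocity hRbig0
    have hV1 : ContDiff ℝ 1 V := hV2.of_le (by norm_num)
    set Φ : ℝ → EuclideanSpace ℝ (Fin 3) → EuclideanSpace ℝ (Fin 3) :=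
      ODE.evolutionMap (fun _ : ℝ => selfSimilarTransport γ 0 V) 0 with hΦ
    have hflow_add : ∀ (s t : ℝ) (y : EuclideanSpace ℝ (Fin 3)), Φ (s + t) y = Φ s (Φ t y) :=
      fun s t y => C2.Kelvin.flow_add (γ := γ) hV1 hK s t y
    have hWU : ∀ z : EuclideanSpace ℝ (Fin 3), ‖z‖ < Rbig → selfSimilarTransport γ 0 V z = selfSimilarTransport γ 0 U z := by
      intro z hz
      simp only [selfSimilarTransport_apply, hVU z (mem_ball_zero_iff.2 hz)]
    have hdiv : ∀ z : EuclideanSpace ℝ (Fin 3), ‖z‖ ≤ Rbig - 1 → VectorCalculus.divergence V z = 0 := by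
      intro z hz
      have hzball : z ∈ ball (0 : EuclideanSpace ℝ (Fin 3)) Rbig := mem_ball_zero_iff.2 (by linarith)
      have hev : V =ᶠ[𝓝 z] U := by
        filter_upwards [isOpen_ball.mem_nhds hzball] with w hw using hVU w hw
      unfold VectorCalculus.divergence
      rw [hev.fderiv_eq]
      exact hprof.divFree z
    have hMRb : M / 2 ≤ Rbig - 1 := by rw [hRbig]; linarith
    -- the stay part `Gs` and the exit part `E`
    set D : Set (EuclideanSpace ℝ (Fin 3)) := {y | ∀ σ ∈ Icc 0 T, ‖Φ (-σ) y‖ ≤ M / 2} with hD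
    have hDc : IsClosed D := by
      have h1 := isClosed_backwardStaySet (γ := γ) hV2 hK (M / 2)
      have h2 : D = (fun y : EuclideanSpace ℝ (Fin 3) => ((T, y) : ℝ × EuclideanSpace ℝ (Fin 3))) ⁻¹'
          {p : ℝ × EuclideanSpace ℝ (Fin 3) | 0 ≤ p.1 ∧ ∀ σ ∈ Icc 0 p.1, ‖Φ (-σ) p.2‖ ≤ M / 2} := by
        ext y
        simp only [hD, mem_setOf_eq, mem_preimage, hT.le, true_and]
      rw [h2]
      exact h1.preimage (continuous_const.prodMk continuous_id)
    have hDm : MeasurableSet D := hDc.measurableSet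
    set Gs : Set (EuclideanSpace ℝ (Fin 3)) := A ∩ D with hGs
    set E : Set (EuclideanSpace ℝ (Fin 3)) := A ∩ {y | ∃ σ ∈ Icc 0 T, M / 2 < ‖Φ (-σ) y‖} with hE
    have hsplit : A ⊆ Gs ∪ E := by
      intro y hy
      by_cases hyD : y ∈ D
      · exact Or.inl ⟨hy, hyD⟩
      · refine Or.inr ⟨hy, ?_⟩
        simp only [hD, mem_setOf_eq, not_forall, not_le, exists_prop] at hyD
        obtain ⟨σ, hσ, hlt⟩ := hyD
        exact ⟨σ, hσ, hlt⟩
    -- ### (1) the stay part: the volume law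
    have hGsm : MeasurableSet Gs := hAm.inter hDm
    have horbit : ∀ y ∈ Gs, ∀ s ∈ Icc 0 T, ‖y‖ * Real.exp (c₁ * s) ≤ ‖Φ (-s) y‖ ∧ h < Hb (Φ (-s) y) := by
      intro y hy s hs
      have hinside : ∀ s ∈ Icc 0 T, ‖Φ (-s) y‖ < Rbig := fun s hs => by linarith [hy.2 s hs]
      have h1 := backwardOrbit_good_of_inside hprof hγ2' hV1 hK hWU hc₁ hfastR (hAR₀ y hy.1) (hA0 y hy.1)
        (hAh y hy.1) (hAcurl y hy.1) hT.le hinside s hs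
      exact ⟨h1.1, h1.2.1⟩
    set B' : Set (EuclideanSpace ℝ (Fin 3)) := Φ T ⁻¹' Gs with hB'
    have hΦTc : Continuous (Φ T) := (C2.Kelvin.contDiff_flow (γ := γ) hV2 hK T).continuous
    have hB'm : MeasurableSet B' := hΦTc.measurable hGsm
    have hΦinv : ∀ y, Φ T (Φ (-T) y) = y := by
      intro y
      have h1 := hflow_add T (-T) y
      rw [add_neg_cancel] at h1
      rw [← h1]; exact ODE.evolutionMap_self _ 0 y
    have hΦinv' : ∀ z, Φ (-T) (Φ T z) = z := by
      intro z
      have h1 := hflow_add (-T) T z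
      rw [neg_add_cancel] at h1
      rw [← h1]; exact ODE.evolutionMap_self _ 0 z
    have hB'eq : ∀ z, z ∈ B' ↔ ∃ y ∈ Gs, z = Φ (-T) y := by
      intro z
      constructor
      · intro hz; exact ⟨Φ T z, hz, (hΦinv' z).symm⟩
      · rintro ⟨y, hy, rfl⟩
        show Φ T (Φ (-T) y) ∈ Gs
        rw [hΦinv y]; exact hy
    have himage : Φ T '' B' = Gs := by
      ext y
      constructor
      · rintro ⟨z, hz, rfl⟩; exact hz
      · intro hy; exact ⟨Φ (-T) y, by show Φ T (Φ (-T) y) ∈ Gs; rw [hΦinv y]; exact hy, hΦinv y⟩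
    have hstay : ∀ z ∈ B', ∀ σ ∈ Icc 0 T, ‖Φ σ z‖ ≤ Rbig - 1 := by
      intro z hz σ hσ
      obtain ⟨y, hy, rfl⟩ := (hB'eq z).1 hz
      have h1 : Φ σ (Φ (-T) y) = Φ (-(T - σ)) y := by
        rw [← hflow_add σ (-T) y]; congr 1; ring
      rw [h1]
      exact (hy.2 (T - σ) ⟨by linarith [hσ.2], by linarith [hσ.1]⟩).trans hMRb
    have hvol : volume Gs = ENNReal.ofReal (Real.exp (3 * γ * T)) * volume B' := by
      rw [← himage]
      exact volume_image_flow_eq_exp_of_stay (γ := γ) hV2 hK hT.le hdiv hB'm hstay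
    have hB'sub : B' ⊆ {z | h < Hb z} ∩ {z | (R - 1) * Real.exp (c₁ * T) ≤ ‖z‖} := by
      intro z hz
      obtain ⟨y, hy, rfl⟩ := (hB'eq z).1 hz
      obtain ⟨hlow, hH⟩ := horbit y hy T ⟨hT.le, le_rfl⟩
      refine ⟨hH, ?_⟩
      show (R - 1) * Real.exp (c₁ * T) ≤ ‖Φ (-T) y‖
      exact (mul_le_mul_of_nonneg_right (hAR y hy.1).le (Real.exp_pos _).le).trans hlow
    have hfarR : R₂ ≤ (R - 1) * Real.exp (c₁ * T) := by
      have h1 : 1 ≤ Real.exp (c₁ * T) := Real.one_le_exp (by positivity)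
      nlinarith
    have hB'vol : volume B' ≤ ENNReal.ofReal (C' * ((R - 1) * Real.exp (c₁ * T)) ^ (-m)) :=
      (measure_mono hB'sub).trans (hthinR' _ hfarR)
    have hGs_le : volume Gs ≤ ENNReal.ofReal (C' * (R - 1) ^ (-m) * Real.exp ((3 * γ - c₁ * m) * T)) := by
      calc volume Gs = ENNReal.ofReal (Real.exp (3 * γ * T)) * volume B' := hvol
        _ ≤ ENNReal.ofReal (Real.exp (3 * γ * T)) * ENNReal.ofReal (C' * ((R - 1) * Real.exp (c₁ * T)) ^ (-m)) :=
            mul_le_mul' le_rfl hB'vol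
        _ = ENNReal.ofReal (C' * (R - 1) ^ (-m) * Real.exp ((3 * γ - c₁ * m) * T)) := by
            rw [← ENNReal.ofReal_mul (Real.exp_pos _).le]
            congr 1
            have := rpow_mul_exp_neg_mul_exp (c₁ := c₁) (m := m) (γ := γ) (T := T) hR0
            calc Real.exp (3 * γ * T) * (C' * ((R - 1) * Real.exp (c₁ * T)) ^ (-m))
                = C' * (Real.exp (3 * γ * T) * ((R - 1) * Real.exp (c₁ * T)) ^ (-m)) := by ring
              _ = C' * ((R - 1) ^ (-m) * Real.exp ((3 * γ - c₁ * m) * T)) := by rw [this]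
              _ = C' * (R - 1) ^ (-m) * Real.exp ((3 * γ - c₁ * m) * T) := by ring
    -- ### (2) the exit part: small measure
    have hAM : ∀ y ∈ A, ‖y‖ < M / 4 := fun y hy => by linarith [hAR1 y hy]
    have hexit := volume_exitSet_mul_le hprof hγ.le hγ2' hV2 hK hWU hdiv hc₁ hfastR hAm hAR₀ hA0 hAh hAcurl hM0 hT hAM hMRb
    have hL2 : 0 < (Real.log 2) ^ 2 / T := by
      have : 0 < Real.log 2 := Real.log_pos (by norm_num)
      positivity
    have hE_le : volume E ≤ ENNReal.ofReal T * ENNReal.ofReal (Real.exp (3 * γ * T)) *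
        (ENNReal.ofReal (2 * γ ^ 2) * ENNReal.ofReal (C' * (M / 4) ^ (-m)) +
          ENNReal.ofReal (32 / M ^ 2) * ENNReal.ofReal (cA' * M ^ θ)) / ENNReal.ofReal ((Real.log 2) ^ 2 / T) := by
      rw [ENNReal.le_div_iff_mul_le (Or.inl (ENNReal.ofReal_pos.2 hL2).ne') (Or.inl ENNReal.ofReal_ne_top)]
      refine hexit.trans ?_
      have h1 : volume ({z : EuclideanSpace ℝ (Fin 3) | h < Hb z} ∩ {z | M / 4 ≤ ‖z‖}) ≤ ENNReal.ofReal (C' * (M / 4) ^ (-m)) :=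
        hthinR' _ (by linarith)
      have h2 : ∫⁻ z in ball (0 : EuclideanSpace ℝ (Fin 3)) M, ‖U z‖ₑ ^ 2 ≤ ENNReal.ofReal (cA' * M ^ θ) := hA' M hM0
      gcongr
    calc volume A ≤ volume (Gs ∪ E) := measure_mono hsplit
      _ ≤ volume Gs + volume E := measure_union_le _ _
      _ ≤ _ := add_le_add hGs_le hE_le
  -- ### `M → ∞`: the squeeze proper, for every `T > 0`
  have hsqueeze : ∀ T : ℝ, 0 < T →
      volume A ≤ ENNReal.ofReal (C' * (R - 1) ^ (-m) * Real.exp ((3 * γ - c₁ * m) * T)) := by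
    intro T hT
    refine ENNReal.le_of_forall_pos_le_add fun δ hδ _ => ?_
    -- the error term as `ofReal` of a real quantity tending to `0`
    set κ : ℝ := T * Real.exp (3 * γ * T) / ((Real.log 2) ^ 2 / T) with hκ
    have hL2 : 0 < (Real.log 2) ^ 2 / T := by
      have : 0 < Real.log 2 := Real.log_pos (by norm_num)
      positivity
    have hκ0 : 0 ≤ κ := by positivity
    have hz := tendsto_exitError (κ₁ := κ * (2 * γ ^ 2 * C')) (κ₂ := κ * (32 * cA')) hm hθ
    have hev := (hz.eventually (gt_mem_nhds (show (0 : ℝ) < δ from by exact_mod_cast hδ))).and (eventually_ge_atTop (4 * (R + 1)))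
    obtain ⟨M, hMδ, hM⟩ := hev.exists
    have hM0 : 0 < M := by linarith
    refine (hkey T hT M hM).trans (add_le_add le_rfl ?_)
    -- rewrite the `ℝ≥0∞` error term as `ofReal` and compare
    have e1 : ENNReal.ofReal T * ENNReal.ofReal (Real.exp (3 * γ * T)) *
          (ENNReal.ofReal (2 * γ ^ 2) * ENNReal.ofReal (C' * (M / 4) ^ (-m)) +
            ENNReal.ofReal (32 / M ^ 2) * ENNReal.ofReal (cA' * M ^ θ)) / ENNReal.ofReal ((Real.log 2) ^ 2 / T) =
        ENNReal.ofReal (κ * (2 * γ ^ 2 * C') * (M / 4) ^ (-m) + κ * (32 * cA') * M ^ (θ - 2)) := by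
      have hM4 : 0 ≤ (M / 4) ^ (-m) := Real.rpow_nonneg (by positivity) _
      have hMθ : 0 ≤ M ^ θ := Real.rpow_nonneg hM0.le _
      rw [← ENNReal.ofReal_mul hT.le, ← ENNReal.ofReal_mul (by positivity : (0 : ℝ) ≤ 2 * γ ^ 2),
        ← ENNReal.ofReal_mul (by positivity : (0 : ℝ) ≤ 32 / M ^ 2),
        ← ENNReal.ofReal_add (by positivity) (by positivity), ← ENNReal.ofReal_mul (by positivity),
        ← ENNReal.ofReal_div_of_pos hL2]
      congr 1
      have hθ2 : M ^ (θ - 2) = M ^ θ / M ^ 2 := by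
        rw [Real.rpow_sub hM0, Real.rpow_two]
      rw [hθ2, hκ]
      field_simp
    rw [e1]
    calc ENNReal.ofReal (κ * (2 * γ ^ 2 * C') * (M / 4) ^ (-m) + κ * (32 * cA') * M ^ (θ - 2))
        ≤ ENNReal.ofReal (δ : ℝ) := ENNReal.ofReal_le_ofReal hMδ.le
      _ = (δ : ℝ≥0∞) := ENNReal.ofReal_coe_nnreal
  -- ### `T → ∞`: `vol A = 0`, absurd
  have hδ : 0 < c₁ * m - 3 * γ := by linarith
  have hA0' : volume A = 0 := by
    by_contra hne
    have hvpos : 0 < (volume A).toReal := ENNReal.toReal_pos hne hAtop.ne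
    obtain ⟨T, hT0, hT⟩ := exists_mul_exp_neg_lt (K := C' * (R - 1) ^ (-m)) hδ hvpos
    have hK0 : 0 ≤ C' * (R - 1) ^ (-m) := mul_nonneg hC'0 (Real.rpow_nonneg hR0.le _)
    have h1 := hsqueeze (T + 1) (by linarith)
    have h2 : C' * (R - 1) ^ (-m) * Real.exp ((3 * γ - c₁ * m) * (T + 1)) < (volume A).toReal := by
      have e : (3 * γ - c₁ * m) * (T + 1) = -((c₁ * m - 3 * γ) * (T + 1)) := by ring
      rw [e]
      have h3 : Real.exp (-((c₁ * m - 3 * γ) * (T + 1))) ≤ Real.exp (-((c₁ * m - 3 * γ) * T)) :=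
        Real.exp_le_exp.2 (by nlinarith)
      exact lt_of_le_of_lt (mul_le_mul_of_nonneg_left h3 hK0) hT
    have h3 : volume A < volume A :=
      lt_of_le_of_lt h1 ((ENNReal.ofReal_lt_ofReal_iff hvpos).2 h2 |>.trans_le (ENNReal.ofReal_toReal hAtop.ne).le)
    exact lt_irrefl _ h3
  exact absurd hA0' hApos.ne'

end Summit.NavierStokesRegularity.NavierStokesRegularity.Theorems.PowerGaugeEulerLiouville.Loc

end
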